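import Literature.NumberTheory.NumberFields.ArithmeticEquivalence
import Literature.NumberTheory.LFunctions.DedekindZetaFunctionalEquationProofs
import Literature.NumberTheory.LFunctions.DedekindZetaThetaProofs
import Literature.NumberTheory.LFunctions.DedekindZetaVonMangoldt
import Mathlib.NumberTheory.NumberField.InfinitePlace.Ramification
import Mathlib.NumberTheory.NumberField.Units.DirichletTheorem
import Mathlib.NumberTheory.NumberField.Discriminant.Basic
import Mathlib.RingTheory.RootsOfUnity.Minpoly
import Mathlib.GroupTheory.SpecificGroups.Cyclic
import HarnessLib

/-!
# Perlis 1977, Theorem 1: proofs — the invariants (signature, discriminant, unit group)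

Topic `NumberTheory/NumberFields` (namespace `Literature.NumberTheory.NumberFields`). Everything in
this file is PROVED (theorems only, no definition, no `sorry`).

Source: R. Perlis, *On the equation `ζ_K(s) = ζ_{K'}(s)`*, J. Number Theory **9** (1977) 342–360
(bib key `Perlis1977`), Theorem 1, the "Furthermore" clause and its proof (pp. 346–347): for
Gassmann equivalent `H = Gal(N/K)`, `H' = Gal(N/K')` (condition (d)),

* `nrRealPlaces_eq_of_card_conj_eq` — the numbers of real places agree. Perlis (p. 346):
  "let `C` be the decomposition group of the real infinite divisor of `ℚ`. The number `n₁(K)` of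
  real valuations of `K` is then the number of double cosets `HgC` of order `|HgC| = |H|`". Here:
  for an embedding `ψ : N → ℂ` and the complex conjugation `c ∈ G` (`ψ ∘ c = conj ∘ ψ`, Mathlib
  `ComplexEmbedding.exists_comp_symm_eq_of_comp_eq`), the embeddings `k ↦ ψ(g(i k))` of `K` are
  parametrised by `G/H`, and `ψ ∘ g ∘ i` is real iff `g⁻¹ c g ∈ H`; so
  `|H| · r₁(K) = #{g : g c g⁻¹ ∈ H}` (`card_conj_mem_eq_card_mul_nrRealPlaces`), a count that
  Gassmann equivalence preserves (`nrRealPlaces_eq_of_card_conj_eq`; the equivalence of Gassmann's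
  condition with the equality of these counts is `isGassmannEquivalent_iff_card_conj` of
  `ArithmeticEquivalenceGassmannProofs.lean`, applied in the assembly file).
* `natAbs_discr_eq_of_dedekindZeta_eq` — `|D_K| = |D_{K'}|` from `ζ_K = ζ_{K'}` and equal
  signatures, by the functional equation (Perlis p. 347, via his Lemma 2; here directly): the
  completed zeta functions `Λ(s) = |D|^{s/2} Γ_ℝ(s)^{r₁} Γ_ℂ(s)^{r₂} ζ(s)` of `K` and `K'` share
  everything but `|D|`, and `Λ(1-s) = Λ(s)` at `s = 5/2` (tree:
  `Literature.NumberTheory.LFunctions.completedDedekindZeta_one_sub_holds`, Hecke's functional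
  equation, with the continuation `dedekindZetaCont` unique off `s = 1`) gives `|D_K|² = |D_{K'}|²`;
  `discr_eq_of_dedekindZeta_eq` adds the sign `(-1)^{r₂}` (Mathlib `NumberField.sign_discr`).
* `torsionOrder_eq_of_isGassmannEquivalent`, `nonempty_unitsMulEquiv_of_eq` — the unit groups:
  "`U_K` is the direct product of a free group and a finite cyclic group generated by the largest
  root of unity in `K`. Adjoining this root of unity to `ℚ` yields a normal extension which … lies
  in `K'`" (p. 347). Here: a generator `ζ` of the roots of unity of `K` is fixed by `H'` (every
  `h' ∈ H'` is `g⁻¹ h g` with `h ∈ H`, and `g ζ` is a power of `ζ`), hence lies in `K'`, so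
  `w_K ∣ w_{K'}`; and `(𝓞 K)ˣ ≅ μ_K × ℤ^{r₁+r₂-1}` (Mathlib's Dirichlet unit theorem
  `NumberField.Units.exist_unique_eq_mul_prod`) with `μ_K` cyclic of order `w_K`.

## References

* [Perlis1977] R. Perlis, *On the equation `ζ_K(s) = ζ_{K'}(s)`*, J. Number Theory 9 (1977),
  342–360: Theorem 1, "Furthermore …" and its proof (pp. 346–347).
* J. Neukirch, *Algebraic Number Theory*, VII (5.10) (functional equation of `ζ_K`), cited through
  the tree file `LFunctions/DedekindZetaFunctionalEquationProofs.lean`. [NeukirchANT1999]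
-/

noncomputable section

open NumberField NumberField.InfinitePlace MulAction
open scoped Pointwise ComplexConjugate

namespace Literature.NumberTheory.NumberFields

/-! ## Real places and complex conjugation -/

section Archimedean

variable {N : Type*} [Field N] [NumberField N] [IsGalois ℚ N]

/-- **The archimedean dictionary** (Perlis p. 346, "the number `n₁(K)` of real valuations of `K`
is the number of double cosets `HgC` of order `|H|`", `C = ⟨c⟩` generated by complex conjugation):
for an embedding `ψ : N → ℂ` with `conj ∘ ψ = ψ ∘ c`,
`#{g ∈ G : g c g⁻¹ ∈ Gal(N/iK)} = |Gal(N/iK)| · r₁(K)`.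
[cite: Perlis1977, proof of Thm. 1, (d) ⇒ (a) (p. 346)] -/
theorem card_conj_mem_eq_card_mul_nrRealPlaces {K : Type*} [Field K] [NumberField K]
    (i : K →ₐ[ℚ] N) (ψ : N →+* ℂ) {c : N ≃ₐ[ℚ] N} (hc : ∀ y : N, conj (ψ y) = ψ (c y)) :
    Nat.card {g : N ≃ₐ[ℚ] N // g * c * g⁻¹ ∈ i.fieldRange.fixingSubgroup} =
      Nat.card i.fieldRange.fixingSubgroup * nrRealPlaces K := by
  classical
  set H := i.fieldRange.fixingSubgroup with hHdef
  -- the embeddings `k ↦ ψ (g (i k))`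
  let Φ : (N ≃ₐ[ℚ] N) → (K →+* ℂ) := fun g =>
    ψ.comp ((g : N ≃ₐ[ℚ] N).toAlgHom.toRingHom.comp i.toRingHom)
  have hΦ : ∀ g k, Φ g k = ψ (g (i k)) := fun g k => rfl
  have hmemH : ∀ g : N ≃ₐ[ℚ] N, g ∈ H ↔ ∀ k : K, g (i k) = i k := by
    intro g
    rw [hHdef, IntermediateField.mem_fixingSubgroup_iff]
    constructor
    · intro hg k
      exact hg (i k) (i.mem_fieldRange.mpr ⟨k, rfl⟩)
    · intro hg y hy
      obtain ⟨k, rfl⟩ := i.mem_fieldRange.mp hy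
      exact hg k
  -- fibres of `Φ` are the cosets of `H`
  have hfib : ∀ g g' : N ≃ₐ[ℚ] N, Φ g = Φ g' ↔ g⁻¹ * g' ∈ H := by
    intro g g'
    rw [hmemH]
    constructor
    · intro he k
      have h1 := RingHom.congr_fun he k
      rw [hΦ, hΦ] at h1
      have h2 : g (i k) = g' (i k) := ψ.injective h1
      rw [AlgEquiv.mul_apply, AlgEquiv.aut_inv, AlgEquiv.symm_apply_eq]
      exact h2.symm
    · intro hk
      refine RingHom.ext fun k => ?_
      rw [hΦ, hΦ]
      have h1 := hk k
      rw [AlgEquiv.mul_apply, AlgEquiv.aut_inv, AlgEquiv.symm_apply_eq] at h1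
      rw [h1]
  -- `Φ g` is real iff `g⁻¹ c g ∈ H`
  have hreal : ∀ g : N ≃ₐ[ℚ] N, ComplexEmbedding.IsReal (Φ g) ↔ g⁻¹ * c * g ∈ H := by
    intro g
    rw [ComplexEmbedding.isReal_iff, hmemH]
    constructor
    · intro he k
      have h1 := RingHom.congr_fun he k
      rw [ComplexEmbedding.conjugate_coe_eq, hΦ, hc] at h1
      have h2 : c (g (i k)) = g (i k) := ψ.injective h1
      rw [AlgEquiv.mul_apply, AlgEquiv.mul_apply, AlgEquiv.aut_inv, AlgEquiv.symm_apply_eq]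
      exact h2
    · intro hk
      refine RingHom.ext fun k => ?_
      rw [ComplexEmbedding.conjugate_coe_eq, hΦ, hc]
      have h1 := hk k
      rw [AlgEquiv.mul_apply, AlgEquiv.mul_apply, AlgEquiv.aut_inv, AlgEquiv.symm_apply_eq] at h1
      rw [h1]
  -- `Φ` descends to a bijection `G/H → (K →+* ℂ)`
  let Φ' : (N ≃ₐ[ℚ] N) ⧸ H → (K →+* ℂ) :=
    Quotient.lift (s := QuotientGroup.leftRel H) Φ fun a b hab =>
      (hfib a b).mpr (QuotientGroup.leftRel_apply.mp hab)
  have hΦ' : ∀ g : N ≃ₐ[ℚ] N, Φ' (g : (N ≃ₐ[ℚ] N) ⧸ H) = Φ g := fun g => rfl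
  have hinj : Function.Injective Φ' := by
    intro a b hab
    induction a using QuotientGroup.induction_on with
    | H a =>
    induction b using QuotientGroup.induction_on with
    | H b =>
    rw [hΦ', hΦ'] at hab
    exact QuotientGroup.eq.mpr ((hfib a b).mp hab)
  letI : Fintype ((N ≃ₐ[ℚ] N) ⧸ H) := Fintype.ofFinite _
  have hHK : Nat.card H * Module.finrank ℚ K = Module.finrank ℚ N := by
    rw [hHdef, IsGalois.card_fixingSubgroup_eq_finrank i.fieldRange,
      i.equivFieldRange.toLinearEquiv.finrank_eq, mul_comm, Module.finrank_mul_finrank]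
  have hcardq : Fintype.card ((N ≃ₐ[ℚ] N) ⧸ H) = Fintype.card (K →+* ℂ) := by
    rw [NumberField.Embeddings.card, Fintype.card_eq_nat_card]
    have h1 := Subgroup.card_eq_card_quotient_mul_card_subgroup H
    rw [IsGalois.card_aut_eq_finrank, ← hHK, mul_comm] at h1
    exact (Nat.eq_of_mul_eq_mul_right Nat.card_pos h1).symm
  have hbij : Function.Bijective Φ' :=
    (Fintype.bijective_iff_injective_and_card Φ').mpr ⟨hinj, hcardq⟩
  have hr : Nat.card {τ : K →+* ℂ // ComplexEmbedding.IsReal τ} = nrRealPlaces K := by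
    rw [← NumberField.InfinitePlace.card_real_embeddings, Nat.card_eq_fintype_card]
  calc Nat.card {g : N ≃ₐ[ℚ] N // g * c * g⁻¹ ∈ H}
      = Nat.card {g : N ≃ₐ[ℚ] N // g⁻¹ * c * g ∈ H} :=
        Nat.card_congr (Equiv.subtypeEquiv (Equiv.inv _) fun g => by
          simp only [Equiv.inv_apply, inv_inv])
    _ = Nat.card (QuotientGroup.mk ⁻¹' {x : (N ≃ₐ[ℚ] N) ⧸ H | ComplexEmbedding.IsReal (Φ' x)}) :=
        Nat.card_congr (Equiv.subtypeEquivRight fun g => by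
          rw [Set.mem_preimage, Set.mem_setOf_eq, hΦ', hreal])
    _ = Nat.card H * Nat.card {x : (N ≃ₐ[ℚ] N) ⧸ H | ComplexEmbedding.IsReal (Φ' x)} := by
        rw [Nat.card_congr (QuotientGroup.preimageMkEquivSubgroupProdSet H _), Nat.card_prod]
    _ = Nat.card H * Nat.card {τ : K →+* ℂ // ComplexEmbedding.IsReal τ} := by
        congr 1
        exact Nat.card_congr (Equiv.subtypeEquiv (Equiv.ofBijective Φ' hbij) fun x => Iff.rfl)
    _ = Nat.card H * nrRealPlaces K := by rw [hr]

/-- **Gassmann equivalent fields have the same number of real places** (Perlis, Theorem 1: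
"the number of real (resp. complex) valuations of `K` and `K'` coincide", proof p. 346). The
Gassmann hypothesis enters as the equality of the counts `#{g : g x g⁻¹ ∈ H} = #{g : g x g⁻¹ ∈ H'}`
for all `x` together with `|H| = |H'|` (both equivalent forms of Gassmann equivalence,
`isGassmannEquivalent_iff_card_conj` and `IsGassmannEquivalent.card_eq`).
[cite: Perlis1977, Thm. 1 and its proof, (d) ⇒ (a) (p. 346)] -/
theorem nrRealPlaces_eq_of_card_conj_eq {N : Type*} [Field N] [NumberField N]
    [IsGalois ℚ N] {K K' : Type*} [Field K] [NumberField K] [Field K'] [NumberField K']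
    (i : K →ₐ[ℚ] N) (i' : K' →ₐ[ℚ] N)
    (hGc : ∀ x : N ≃ₐ[ℚ] N,
      Nat.card {g : N ≃ₐ[ℚ] N // g * x * g⁻¹ ∈ i.fieldRange.fixingSubgroup} =
        Nat.card {g : N ≃ₐ[ℚ] N // g * x * g⁻¹ ∈ i'.fieldRange.fixingSubgroup})
    (hH : Nat.card i.fieldRange.fixingSubgroup = Nat.card i'.fieldRange.fixingSubgroup) :
    nrRealPlaces K = nrRealPlaces K' := by
  -- an embedding of `N` in `ℂ` and the corresponding complex conjugation
  obtain ⟨ψ⟩ : Nonempty (N →+* ℂ) := by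
    rw [← Fintype.card_pos_iff, NumberField.Embeddings.card]
    exact Module.finrank_pos
  obtain ⟨σ, hσ⟩ := NumberField.ComplexEmbedding.exists_comp_symm_eq_of_comp_eq (k := ℚ) ψ
    ((starRingEnd ℂ).comp ψ) (Subsingleton.elim _ _)
  have hc : ∀ y : N, conj (ψ y) = ψ (σ.symm y) := fun y => by
    have := RingHom.congr_fun hσ y
    simp only [RingHom.coe_comp, Function.comp_apply] at this
    exact this.symm
  have h1 := card_conj_mem_eq_card_mul_nrRealPlaces i ψ hc
  have h2 := card_conj_mem_eq_card_mul_nrRealPlaces i' ψ hc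
  rw [hGc σ.symm, h2, hH] at h1
  exact (Nat.eq_of_mul_eq_mul_left Nat.card_pos h1).symm

end Archimedean

/-! ## The discriminant, from the functional equation -/

section Discriminant

open Complex Literature.NumberTheory.LFunctions

/-- **Equal zeta functions and equal signatures force `|D_K| = |D_{K'}|`** (Perlis, Theorem 1,
proof p. 347: from the functional equations, `ζ_K/ζ_{K'} = |D_K/D_{K'}|^{1/2-s} ζ_K(1-s)/ζ_{K'}(1-s)`,
so `|D_K/D_{K'}|^{1/2-s} ≡ 1`; here evaluated at `s = 5/2` with the tree's proved functional
equation `Λ_K(1-s) = Λ_K(s)` and the uniqueness of the continuation of `ζ_K`).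
[cite: Perlis1977, proof of Thm. 1 (p. 347, "`|D_K| = |D_{K'}|`")] -/
theorem natAbs_discr_eq_of_dedekindZeta_eq {K K' : Type*} [Field K] [NumberField K] [Field K']
    [NumberField K'] (hζ : NumberField.dedekindZeta K = NumberField.dedekindZeta K')
    (hr1 : nrRealPlaces K = nrRealPlaces K') (hr2 : nrComplexPlaces K = nrComplexPlaces K') :
    (NumberField.discr K).natAbs = (NumberField.discr K').natAbs := by
  -- the continuations agree off `s = 1`
  have hK := Literature.NumberTheory.LFunctions.NumberField.isDedekindZetaContinuation_dedekindZetaCont_holds K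
  have hK' :=
    Literature.NumberTheory.LFunctions.NumberField.isDedekindZetaContinuation_dedekindZetaCont_holds K'
  have hK'' : IsDedekindZetaContinuation K (dedekindZetaCont K') :=
    ⟨hK'.differentiableOn, by rw [hζ]; exact hK'.eqOn⟩
  have hcont : Set.EqOn (dedekindZetaCont K) (dedekindZetaCont K') {1}ᶜ := hK.unique hK''
  -- the point `s₀ = 5/2`
  set s₀ : ℂ := 5 / 2 with hs₀
  have hs₀re : s₀.re = 5 / 2 := by norm_num [hs₀]
  have hs₀Z : ∀ n : ℤ, s₀ ≠ n := by
    intro n h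
    have h1 := congrArg Complex.re h
    rw [hs₀re, intCast_re] at h1
    have h2 : (2 * n : ℝ) = 5 := by linarith
    have h3 : (2 * n : ℤ) = 5 := by exact_mod_cast h2
    omega
  have hs₀1 : s₀ ≠ 1 := by
    intro h
    have h1 := congrArg Complex.re h
    rw [hs₀re, one_re] at h1
    norm_num at h1
  have hs₀1' : 1 - s₀ ≠ 1 := by
    intro h
    have h1 := congrArg Complex.re h
    rw [sub_re, hs₀re, one_re] at h1
    norm_num at h1
  have hre : 1 < s₀.re := by rw [hs₀re]; norm_num
  -- functional equations at `s₀`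
  have hFE := completedDedekindZeta_one_sub_holds (K := K) hs₀Z
  have hFE' := completedDedekindZeta_one_sub_holds (K := K') hs₀Z
  simp only [completedDedekindZeta, dedekindGammaFactor, mul_assoc] at hFE hFE'
  rw [← hr1, ← hr2, ← hcont hs₀1', ← hcont hs₀1] at hFE'
  set a : ℂ := ((NumberField.discr K).natAbs : ℂ) with ha
  set a' : ℂ := ((NumberField.discr K').natAbs : ℂ) with ha'
  set u : ℂ := Gammaℝ (1 - s₀) ^ nrRealPlaces K * (Gammaℂ (1 - s₀) ^ nrComplexPlaces K *
    dedekindZetaCont K (1 - s₀)) with hu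
  set v : ℂ := Gammaℝ s₀ ^ nrRealPlaces K * (Gammaℂ s₀ ^ nrComplexPlaces K *
    dedekindZetaCont K s₀) with hv
  have ha0 : a ≠ 0 := by
    rw [ha, Nat.cast_ne_zero]
    exact Int.natAbs_ne_zero.mpr (NumberField.discr_ne_zero K)
  have ha0' : a' ≠ 0 := by
    rw [ha', Nat.cast_ne_zero]
    exact Int.natAbs_ne_zero.mpr (NumberField.discr_ne_zero K')
  have hv0 : v ≠ 0 := by
    have h0 : (0 : ℝ) < s₀.re := by rw [hs₀re]; norm_num
    -- `Γ_ℂ(s₀) = Γ_ℝ(s₀) Γ_ℝ(s₀ + 1) ≠ 0`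
    have hΓℂ : Gammaℂ s₀ ≠ 0 := by
      rw [← Gammaℝ_mul_Gammaℝ_add_one]
      refine mul_ne_zero (Gammaℝ_ne_zero_of_re_pos h0) (Gammaℝ_ne_zero_of_re_pos ?_)
      simp only [add_re, one_re]
      linarith
    refine mul_ne_zero (pow_ne_zero _ (Gammaℝ_ne_zero_of_re_pos h0))
      (mul_ne_zero (pow_ne_zero _ hΓℂ) ?_)
    rw [hK.eqOn hre]
    exact Literature.NumberTheory.LFunctions.NumberField.dedekindZeta_ne_zero_of_one_lt_re (K := K) hre
  -- `b^{(1-s₀)/2} u = b^{s₀/2} v` gives `u = b² v`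
  have key : ∀ b : ℂ, b ≠ 0 → b ^ ((1 - s₀) / 2) * u = b ^ (s₀ / 2) * v →
      u = b ^ (2 : ℂ) * v := by
    intro b hb h
    have hsplit : b ^ (s₀ / 2) = b ^ ((1 - s₀) / 2) * b ^ (2 : ℂ) := by
      rw [← cpow_add _ _ hb]
      congr 1
      rw [hs₀]
      ring
    rw [hsplit, mul_assoc] at h
    have hne : b ^ ((1 - s₀) / 2) ≠ 0 := fun h0 => hb ((cpow_eq_zero_iff _ _).mp h0).1
    exact mul_left_cancel₀ hne h
  have hu1 : u = a ^ (2 : ℂ) * v := key a ha0 hFE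
  have hu2 : u = a' ^ (2 : ℂ) * v := key a' ha0' hFE'
  have hsq : a ^ (2 : ℂ) = a' ^ (2 : ℂ) := mul_right_cancel₀ hv0 (hu1.symm.trans hu2)
  rw [show (2 : ℂ) = ((2 : ℕ) : ℂ) by norm_num, cpow_natCast, cpow_natCast, ha, ha'] at hsq
  have hsq' : ((NumberField.discr K).natAbs ^ 2 : ℕ) = (NumberField.discr K').natAbs ^ 2 := by
    exact_mod_cast hsq
  exact Nat.pow_left_injective two_ne_zero hsq'

/-- **… and with the sign `(-1)^{r₂}` (Mathlib `NumberField.sign_discr`) the discriminants agree**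
(Perlis p. 347: "Since the sign of `D_K` is `(-1)^{r₂(K)}` … the discriminants agree").
[cite: Perlis1977, proof of Thm. 1 (p. 347)] -/
theorem discr_eq_of_dedekindZeta_eq {K K' : Type*} [Field K] [NumberField K] [Field K']
    [NumberField K'] (hζ : NumberField.dedekindZeta K = NumberField.dedekindZeta K')
    (hr1 : nrRealPlaces K = nrRealPlaces K') (hr2 : nrComplexPlaces K = nrComplexPlaces K') :
    NumberField.discr K = NumberField.discr K' := by
  have h1 := natAbs_discr_eq_of_dedekindZeta_eq hζ hr1 hr2
  have h2 : (NumberField.discr K).sign = (NumberField.discr K').sign := by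
    rw [NumberField.sign_discr, NumberField.sign_discr, hr2]
  rw [← Int.sign_mul_natAbs (NumberField.discr K), ← Int.sign_mul_natAbs (NumberField.discr K'),
    h1, h2]

end Discriminant

/-! ## The unit group -/

section Units

open NumberField.Units

/-- **Dirichlet's unit theorem as a group isomorphism**: `(𝓞 K)ˣ ≅ μ_K × ℤ^{rank K}` (Mathlib
`NumberField.Units.exist_unique_eq_mul_prod`: every unit is uniquely `ζ ∏ᵢ εᵢ^{eᵢ}`).
[folklore] -/
theorem nonempty_unitsMulEquiv (K : Type*) [Field K] [NumberField K] :
    Nonempty ((𝓞 K)ˣ ≃* torsion K × (Fin (rank K) → Multiplicative ℤ)) := by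
  classical
  let f : torsion K × (Fin (rank K) → Multiplicative ℤ) →* (𝓞 K)ˣ :=
    { toFun := fun q => (q.1 : (𝓞 K)ˣ) * ∏ j, fundSystem K j ^ (Multiplicative.toAdd (q.2 j))
      map_one' := by simp
      map_mul' := fun q q' => by
        simp only [Prod.fst_mul, Prod.snd_mul, Pi.mul_apply, toAdd_mul, zpow_add,
          Finset.prod_mul_distrib, Subgroup.coe_mul]
        rw [mul_mul_mul_comm] }
  have hf : ∀ q, f q = (q.1 : (𝓞 K)ˣ) * ∏ j, fundSystem K j ^ (Multiplicative.toAdd (q.2 j)) :=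
    fun q => rfl
  have hbij : Function.Bijective f := by
    constructor
    · intro q q' h
      obtain ⟨ζe, -, huniq⟩ := exist_unique_eq_mul_prod K (f q)
      have hq : (q.1, fun j => Multiplicative.toAdd (q.2 j)) = ζe := huniq _ (hf q)
      have hq' : (q'.1, fun j => Multiplicative.toAdd (q'.2 j)) = ζe := huniq _ (by rw [h, hf])
      have hqq := hq.trans hq'.symm
      simp only [Prod.mk.injEq] at hqq
      refine Prod.ext hqq.1 (funext fun j => ?_)
      exact Multiplicative.toAdd.injective (congr_fun hqq.2 j)
    · intro x
      obtain ⟨⟨ζ, e⟩, hx, -⟩ := exist_unique_eq_mul_prod K x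
      refine ⟨(ζ, fun j => Multiplicative.ofAdd (e j)), ?_⟩
      rw [hf, hx]
      rfl
  exact ⟨(MulEquiv.ofBijective f hbij).symm⟩

/-- `ℤ^r ≅ ℤ^{r'}` when `r = r'`. [folklore] -/
theorem nonempty_mulEquiv_pi_fin {M : Type*} [Mul M] {r r' : ℕ} (h : r = r') :
    Nonempty ((Fin r → M) ≃* (Fin r' → M)) := by
  subst h
  exact ⟨MulEquiv.refl _⟩

/-- **Isomorphic unit groups from equal invariants**: number fields with the same number of roots
of unity and the same unit rank have isomorphic unit groups (Perlis p. 347: "Since the unit ranks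
… coincide, the unit groups `U_K ≅ U_{K'}` are isomorphic"). [cite: Perlis1977, proof of Thm. 1 (p. 347)] -/
theorem nonempty_unitsMulEquiv_of_eq {K K' : Type*} [Field K] [NumberField K] [Field K']
    [NumberField K'] (hw : torsionOrder K = torsionOrder K') (hr : rank K = rank K') :
    Nonempty ((𝓞 K)ˣ ≃* (𝓞 K')ˣ) := by
  obtain ⟨e⟩ := nonempty_unitsMulEquiv K
  obtain ⟨e'⟩ := nonempty_unitsMulEquiv K'
  obtain ⟨ef⟩ := nonempty_mulEquiv_pi_fin (M := Multiplicative ℤ) hr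
  have et : torsion K ≃* torsion K' := mulEquivOfCyclicCardEq hw
  exact ⟨e.trans ((MulEquiv.prodCongr et ef).trans e'.symm)⟩

/-- The unit rank is `r₁ + r₂ - 1`. [folklore] -/
theorem rank_eq (K : Type*) [Field K] [NumberField K] :
    rank K = nrRealPlaces K + nrComplexPlaces K - 1 := by
  rw [rank, card_eq_nrRealPlaces_add_nrComplexPlaces]

variable {N : Type*} [Field N] [NumberField N] [IsGalois ℚ N]

/-- **Gassmann equivalent fields contain the same roots of unity** (Perlis p. 347: adjoining the
largest root of unity of `K` gives a normal extension of `ℚ` inside `K`, hence inside `K'`; here: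
a generator `ζ` of `μ_K`, embedded in `N`, is fixed by every `h' ∈ Gal(N/K')`, because
`h' = g⁻¹ h g` with `h ∈ Gal(N/K)` and `g ζ` is a power of `ζ`; so `ζ ∈ K'` and `w_K ∣ w_{K'}`).
[cite: Perlis1977, proof of Thm. 1 (p. 347)] -/
theorem torsionOrder_dvd_of_isGassmannEquivalent {K K' : Type*} [Field K] [NumberField K]
    [Field K'] [NumberField K'] (i : K →ₐ[ℚ] N) (i' : K' →ₐ[ℚ] N)
    (hG : IsGassmannEquivalent i.fieldRange.fixingSubgroup i'.fieldRange.fixingSubgroup) :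
    torsionOrder K ∣ torsionOrder K' := by
  classical
  haveI : NeZero (torsionOrder K) := ⟨torsionOrder_ne_zero K⟩
  -- a generator of the roots of unity of `K`
  obtain ⟨g, hg⟩ := IsCyclic.exists_generator (α := torsion K)
  have hordg : orderOf g = torsionOrder K := orderOf_eq_card_of_forall_mem_zpowers hg
  have hprimU : IsPrimitiveRoot (g : (𝓞 K)ˣ) (torsionOrder K) := by
    rw [← hordg, ← Subgroup.orderOf_coe]
    exact IsPrimitiveRoot.orderOf _
  have hprimK : IsPrimitiveRoot (((g : (𝓞 K)ˣ) : 𝓞 K) : K) (torsionOrder K) :=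
    (IsPrimitiveRoot.coe_units_iff.mpr hprimU).map_of_injective (RingOfIntegers.coe_injective)
  set y : N := i (((g : (𝓞 K)ˣ) : 𝓞 K) : K) with hy
  have hprimN : IsPrimitiveRoot y (torsionOrder K) := hprimK.map_of_injective i.injective
  -- `y` is fixed by `H' = Gal(N/i'K')`
  have hfix : ∀ h' ∈ i'.fieldRange.fixingSubgroup, h' y = y := by
    intro h' hh'
    -- some conjugate of `h'` lies in `H`
    have hcard := hG h'
    have hne : Nat.card {h : i'.fieldRange.fixingSubgroup // IsConj h' (h : N ≃ₐ[ℚ] N)} ≠ 0 :=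
      Nat.card_ne_zero.mpr ⟨⟨⟨⟨h', hh'⟩, IsConj.refl h'⟩⟩, inferInstance⟩
    rw [← hcard] at hne
    obtain ⟨⟨⟨h, hh⟩, hconj⟩⟩ := (Nat.card_ne_zero.mp hne).1
    obtain ⟨c, hc⟩ := isConj_iff.mp hconj
    -- `c y` is a root of unity of order dividing `w`, hence a power of `y`
    have hcy : (c y) ^ torsionOrder K = 1 := by
      rw [← map_pow, hprimN.pow_eq_one, map_one]
    obtain ⟨a, -, ha⟩ := hprimN.eq_pow_of_pow_eq_one hcy
    -- `h` fixes `y` (and its powers)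
    have hhy : h y = y :=
      (IntermediateField.mem_fixingSubgroup_iff _ h).mp hh y (i.mem_fieldRange.mpr ⟨_, rfl⟩)
    have h1 : h (c y) = c y := by rw [← ha, map_pow, hhy]
    -- `h' = c⁻¹ h c`
    have hc' : c * h' * c⁻¹ = h := hc
    have h2 : h' = c⁻¹ * h * c := by
      rw [← hc']
      group
    rw [h2, AlgEquiv.mul_apply, AlgEquiv.mul_apply, h1, AlgEquiv.aut_inv,
      AlgEquiv.symm_apply_apply]
  -- hence `y ∈ i' K'`
  have hyK' : y ∈ i'.fieldRange := by
    rw [← IsGalois.fixedField_fixingSubgroup i'.fieldRange]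
    exact fun h' => hfix h'.1 h'.2
  obtain ⟨k', hk'⟩ := i'.mem_fieldRange.mp hyK'
  have hprimK' : IsPrimitiveRoot k' (torsionOrder K) := by
    rw [← hk'] at hprimN
    exact hprimN.of_map_of_injective i'.injective
  -- an element of `μ_{K'}` of order `w_K`
  have hpos : 0 < torsionOrder K := torsionOrder_pos K
  set t : 𝓞 K' := ⟨k', hprimK'.isIntegral hpos⟩ with ht
  have hprimt : IsPrimitiveRoot t (torsionOrder K) :=
    hprimK'.of_map_of_injective (f := algebraMap (𝓞 K') K') RingOfIntegers.coe_injective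
  set u : (𝓞 K')ˣ := (hprimt.isUnit hpos.ne').unit with hudef
  have hprimu : IsPrimitiveRoot u (torsionOrder K) :=
    IsPrimitiveRoot.coe_units_iff.mp (by rw [hudef, IsUnit.unit_spec]; exact hprimt)
  have hutor : u ∈ torsion K' := by
    rw [torsion, CommGroup.mem_torsion, isOfFinOrder_iff_pow_eq_one]
    exact ⟨torsionOrder K, hpos, hprimu.pow_eq_one⟩
  have hord : orderOf (⟨u, hutor⟩ : torsion K') = torsionOrder K := by
    rw [Subgroup.orderOf_mk, ← hprimu.eq_orderOf]
  rw [← hord, torsionOrder]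
  exact orderOf_dvd_natCard _

/-- **Gassmann equivalent fields have the same number of roots of unity.**
[cite: Perlis1977, proof of Thm. 1 (p. 347: "`K` and `K'` contain the same roots of unity")] -/
theorem torsionOrder_eq_of_isGassmannEquivalent {K K' : Type*} [Field K] [NumberField K]
    [Field K'] [NumberField K'] (i : K →ₐ[ℚ] N) (i' : K' →ₐ[ℚ] N)
    (hG : IsGassmannEquivalent i.fieldRange.fixingSubgroup i'.fieldRange.fixingSubgroup) :
    torsionOrder K = torsionOrder K' :=
  Nat.dvd_antisymm (torsionOrder_dvd_of_isGassmannEquivalent i i' hG)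
    (torsionOrder_dvd_of_isGassmannEquivalent i' i hG.symm)

end Units

end Literature.NumberTheory.NumberFields
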